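import Literature.NumberTheory.Automorphic.PadicPlaceCoefficientRing
import Mathlib.RingTheory.DedekindDomain.IntegralClosure
import Mathlib.RingTheory.Valuation.Integral
import HarnessLib

/-!
# The coefficient ring `𝒪_E = {x ∈ E : |x| ≤ 1}` is the integral closure of `ℤ_p` in `E`, hence a
# finite free `ℤ_p`-module and a Noetherian ring

Topic `NumberTheory/Automorphic`; namespace `Literature.NumberTheory.Automorphic.ParallelWeight`.
Theorems and the algebra-structure instances on the types `coeffField K p`, `coeffRing K p` of
`PadicPlaceCoefficientRing` that state them; no named fact, no `sorry`.

* `isIntegral_padicInt_iff_norm_le_one` — **an element of `ℚ̄_p` is integral over `ℤ_p` iff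
  `|x| ≤ 1`**: `⇐` because the norm of `ℚ̄_p` IS the spectral norm, `|x| = spectralValue (minpoly x)`,
  so `|x| ≤ 1` forces all coefficients of the minimal polynomial into `ℤ_p`
  (Mathlib `spectralValue_le_one_iff`, `Polynomial.lifts_and_natDegree_eq_and_monic`); `⇒` because the
  valuation ring `ℤ̄_p ⊇ ℤ_p` is integrally closed (`Valuation.Integers.mem_of_integral`);
* hence `coeffRing K p` is the integral closure of `ℤ_p` in the finite extension `coeffField K p`
  (`IsIntegralClosure`), so by Mathlib's `IsIntegralClosure.finite / isNoetherianRing / module_free`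
  (finite separable extensions of the fraction field of an integrally closed Noetherian domain):
  **`Module.Finite ℤ_[p] (coeffRing K p)`**, **`IsNoetherianRing (coeffRing K p)`**,
  `Module.Free ℤ_[p] (coeffRing K p)` — the standard "𝒪_E is a free ℤ_p-module of rank `[E:ℚ_p]`"
  [NeukirchANT1999, Ch. II (6.8) with (4.8)]; cf. Serre, *Local Fields*, Ch. II §2, Prop. 3.

These make the lattices `M_λ` over `𝒪_E` and the cohomology groups built from them finitely
generated `ℤ_p`-modules, as needed for the integrality of Hecke eigenvalues in
[Scholze2015, §V.4, proof of Thm. V.4.1].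

## References

* J. Neukirch, *Algebraic Number Theory* (1999), Ch. II (4.8), (6.8), §8. [NeukirchANT1999]
* J.-P. Serre, *Local Fields*, GTM 67, Ch. II §2, Prop. 3. [folklore]
* P. Scholze, Ann. of Math. 182 (2015), §V.4. [Scholze2015]
-/

noncomputable section

open scoped NumberField
open Polynomial

namespace Literature.NumberTheory.Automorphic.ParallelWeight

variable (p : ℕ) [Fact p.Prime]

/-! ### Integrality over `ℤ_p` in `ℚ̄_p` is `|x| ≤ 1` -/

/-- The image of `ℤ_p` in `ℚ̄_p` lies in the closed unit ball. [folklore] -/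
theorem norm_algebraMap_padicInt_le_one (z : ℤ_[p]) : ‖algebraMap ℤ_[p] (PadicAlgCl p) z‖ ≤ 1 := by
  rw [IsScalarTower.algebraMap_apply ℤ_[p] ℚ_[p] (PadicAlgCl p),
    show algebraMap ℚ_[p] (PadicAlgCl p) (algebraMap ℤ_[p] ℚ_[p] z) =
      ((algebraMap ℤ_[p] ℚ_[p] z : ℚ_[p]) : PadicAlgCl p) from rfl,
    PadicAlgCl.norm_extends]
  exact PadicInt.norm_le_one z

/-- **`|x| ≤ 1 ⇒ x` is integral over `ℤ_p`** (`x ∈ ℚ̄_p`): the norm is the spectral norm, so the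
minimal polynomial of `x` over `ℚ_p` has coefficients of norm `≤ 1`, i.e. in `ℤ_p`.
[cite: NeukirchANT1999, Ch. II (4.8) and (6.2)] -/
theorem isIntegral_padicInt_of_norm_le_one {x : PadicAlgCl p} (hx : ‖x‖ ≤ 1) : IsIntegral ℤ_[p] x := by
  have halg : IsIntegral ℚ_[p] x := Algebra.IsIntegral.isIntegral x
  have hP : (minpoly ℚ_[p] x).Monic := minpoly.monic halg
  have hsv : spectralValue (minpoly ℚ_[p] x) ≤ 1 := by
    change spectralNorm ℚ_[p] (PadicAlgCl p) x ≤ 1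
    rw [PadicAlgCl.spectralNorm_eq]
    exact hx
  have hcoeff : ∀ n, ‖(minpoly ℚ_[p] x).coeff n‖ ≤ 1 := (spectralValue_le_one_iff hP).1 hsv
  have hlifts : minpoly ℚ_[p] x ∈ Polynomial.lifts (algebraMap ℤ_[p] ℚ_[p]) := by
    rw [Polynomial.lifts_iff_coeff_lifts]
    intro n
    exact ⟨⟨(minpoly ℚ_[p] x).coeff n, hcoeff n⟩, rfl⟩
  obtain ⟨Q, hQP, -, hQm⟩ := Polynomial.lifts_and_natDegree_eq_and_monic hlifts hP
  refine ⟨Q, hQm, ?_⟩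
  rw [← Polynomial.aeval_def, ← Polynomial.aeval_map_algebraMap ℚ_[p], hQP, minpoly.aeval]

/-- **`x` integral over `ℤ_p ⇒ |x| ≤ 1`**: `ℤ̄_p ⊇ ℤ_p` is a valuation ring, integrally closed.
[folklore] -/
theorem norm_le_one_of_isIntegral_padicInt {x : PadicAlgCl p} (hx : IsIntegral ℤ_[p] x) : ‖x‖ ≤ 1 := by
  let O := (Valued.v : Valuation (PadicAlgCl p) NNReal).integer
  have hO : (Valued.v : Valuation (PadicAlgCl p) NNReal).Integers O := Valuation.integer.integers _
  -- `ℤ_p → O`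
  have hZ : ∀ z : ℤ_[p], algebraMap ℤ_[p] (PadicAlgCl p) z ∈ O := fun z => by
    rw [Valuation.mem_integer_iff, PadicAlgCl.valuation_def, ← NNReal.coe_le_coe, coe_nnnorm,
      NNReal.coe_one]
    exact norm_algebraMap_padicInt_le_one p z
  letI : Algebra ℤ_[p] O := ((algebraMap ℤ_[p] (PadicAlgCl p)).codRestrict O hZ).toAlgebra
  haveI : IsScalarTower ℤ_[p] O (PadicAlgCl p) := IsScalarTower.of_algebraMap_eq fun _ => rfl
  have hx' : IsIntegral O x := hx.tower_top
  have h := Valuation.Integers.mem_of_integral hO hx'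
  rw [Valuation.mem_integer_iff, PadicAlgCl.valuation_def, ← NNReal.coe_le_coe, coe_nnnorm,
    NNReal.coe_one] at h
  exact h

/-- **Integral over `ℤ_p ⇔ |x| ≤ 1`** in `ℚ̄_p`. [cite: NeukirchANT1999, Ch. II (4.8), (6.2)] -/
theorem isIntegral_padicInt_iff_norm_le_one (x : PadicAlgCl p) : IsIntegral ℤ_[p] x ↔ ‖x‖ ≤ 1 :=
  ⟨norm_le_one_of_isIntegral_padicInt p, isIntegral_padicInt_of_norm_le_one p⟩

/-! ### `𝒪_E` is the integral closure of `ℤ_p` in `E` -/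

variable (K : Type) [Field K] [NumberField K]

/-- `E` as an algebra over `ℤ_p` (through `ℚ_p`). [folklore] -/
instance : Algebra ℤ_[p] (coeffField K p) :=
  ((algebraMap ℚ_[p] (coeffField K p)).comp (algebraMap ℤ_[p] ℚ_[p])).toAlgebra

/-- `ℤ_p → ℚ_p → E` commutes. [folklore] -/
instance : IsScalarTower ℤ_[p] ℚ_[p] (coeffField K p) :=
  IsScalarTower.of_algebraMap_eq fun _ => rfl

/-- `ℤ_p → E` is injective. [folklore] -/
instance : FaithfulSMul ℤ_[p] (coeffField K p) :=
  (faithfulSMul_iff_algebraMap_injective ℤ_[p] (coeffField K p)).2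
    ((algebraMap ℚ_[p] (coeffField K p)).injective.comp (IsFractionRing.injective ℤ_[p] ℚ_[p]))

/-- `𝒪_E ⊆ E` as an algebra. [folklore] -/
instance : Algebra (coeffRing K p) (coeffField K p) :=
  (Subring.inclusion (inf_le_left : coeffRing K p ≤ (coeffField K p).toSubring)).toAlgebra

/-- `algebraMap 𝒪_E E` is the inclusion. [folklore] -/
theorem coe_algebraMap_coeffRing (y : coeffRing K p) :
    ((algebraMap (coeffRing K p) (coeffField K p) y : coeffField K p) : PadicAlgCl p) = y :=
  rfl

/-- `ℤ_p → 𝒪_E`. [folklore] -/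
theorem algebraMap_padicInt_mem_coeffRing (z : ℤ_[p]) :
    algebraMap ℤ_[p] (PadicAlgCl p) z ∈ coeffRing K p := by
  rw [mem_coeffRing_iff]
  refine ⟨?_, ?_⟩
  · rw [IsScalarTower.algebraMap_apply ℤ_[p] ℚ_[p] (PadicAlgCl p)]
    exact (coeffField K p).algebraMap_mem _
  · rw [PadicAlgCl.valuation_def, ← NNReal.coe_le_coe, coe_nnnorm, NNReal.coe_one]
    exact norm_algebraMap_padicInt_le_one p z

/-- `𝒪_E` as an algebra over `ℤ_p`. [folklore] -/
instance : Algebra ℤ_[p] (coeffRing K p) :=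
  ((algebraMap ℤ_[p] (PadicAlgCl p)).codRestrict (coeffRing K p)
    (algebraMap_padicInt_mem_coeffRing p K)).toAlgebra

/-- `ℤ_p → 𝒪_E → E` commutes. [folklore] -/
instance : IsScalarTower ℤ_[p] (coeffRing K p) (coeffField K p) :=
  IsScalarTower.of_algebraMap_eq fun _ => Subtype.ext rfl

/-- `ℤ_p → 𝒪_E → ℚ̄_p` commutes. [folklore] -/
instance : IsScalarTower ℤ_[p] (coeffRing K p) (PadicAlgCl p) :=
  IsScalarTower.of_algebraMap_eq fun _ => rfl

/-- Integrality over `ℤ_p` of an element of `E` is integrality in `ℚ̄_p`. [folklore] -/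
theorem isIntegral_coeffField_iff (x : coeffField K p) :
    IsIntegral ℤ_[p] x ↔ IsIntegral ℤ_[p] (x : PadicAlgCl p) := by
  have h : Function.Injective ((coeffField K p).val.restrictScalars ℤ_[p]) := Subtype.val_injective
  exact (isIntegral_algHom_iff _ h).symm

/-- **`𝒪_E` is the integral closure of `ℤ_p` in `E`.** [cite: NeukirchANT1999, Ch. II (6.2) and §8] -/
instance isIntegralClosure_coeffRing : IsIntegralClosure (coeffRing K p) ℤ_[p] (coeffField K p) where
  algebraMap_injective := fun a b h => Subtype.ext (by
    have := congrArg (fun y : coeffField K p => (y : PadicAlgCl p)) h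
    exact this)
  isIntegral_iff := fun {x} => by
    rw [isIntegral_coeffField_iff, isIntegral_padicInt_iff_norm_le_one]
    constructor
    · intro hx
      refine ⟨⟨(x : PadicAlgCl p), (mem_coeffRing_iff K p).2 ⟨x.2, ?_⟩⟩, Subtype.ext rfl⟩
      rw [PadicAlgCl.valuation_def, ← NNReal.coe_le_coe, coe_nnnorm, NNReal.coe_one]
      exact hx
    · rintro ⟨y, rfl⟩
      have hy := valued_le_one_of_mem_coeffRing K p y.2
      rw [PadicAlgCl.valuation_def, ← NNReal.coe_le_coe, coe_nnnorm, NNReal.coe_one] at hy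
      exact hy

/-! ### Finiteness -/

/-- `E / ℚ_p` is finite (instance form of `finiteDimensional_coeffField`). [folklore] -/
instance : FiniteDimensional ℚ_[p] (coeffField K p) := finiteDimensional_coeffField K p

/-- **`𝒪_E` is a finitely generated `ℤ_p`-module.** [cite: NeukirchANT1999, Ch. II (6.8) with (4.8)] -/
instance moduleFinite_coeffRing : Module.Finite ℤ_[p] (coeffRing K p) :=
  IsIntegralClosure.finite ℤ_[p] ℚ_[p] (coeffField K p) (coeffRing K p)

/-- **`𝒪_E` is a Noetherian ring.** [folklore] -/
instance isNoetherianRing_coeffRing : IsNoetherianRing (coeffRing K p) :=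
  IsIntegralClosure.isNoetherianRing ℤ_[p] ℚ_[p] (coeffField K p) (coeffRing K p)

/-- **`𝒪_E` is a free `ℤ_p`-module.** [cite: NeukirchANT1999, Ch. II (6.8)] -/
instance moduleFree_coeffRing : Module.Free ℤ_[p] (coeffRing K p) :=
  IsIntegralClosure.module_free ℤ_[p] ℚ_[p] (coeffField K p) (coeffRing K p)

/-- Every finitely generated `𝒪_E`-module is finitely generated over `ℤ_p`. [folklore] -/
theorem moduleFinite_padicInt_of_moduleFinite_coeffRing (M : Type*) [AddCommGroup M]
    [Module (coeffRing K p) M] [Module ℤ_[p] M] [IsScalarTower ℤ_[p] (coeffRing K p) M]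
    [Module.Finite (coeffRing K p) M] : Module.Finite ℤ_[p] M :=
  Module.Finite.trans (coeffRing K p) M

end Literature.NumberTheory.Automorphic.ParallelWeight
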